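import Summits.MatrixMultiplication.MatrixMultiplication.Theorems.PairwiseCurvedTilingsLC.Negative.TermDeterminant
import Summits.MatrixMultiplication.MatrixMultiplication.Theorems.PairwiseCurvedTilingsLC.Negative.TermBoxPolynomial
import Literature.ModelTheory.PseudofiniteFields.EtaleOpenTopology
import Literature.ModelTheory.PseudofiniteFields.DefinablePredicates
import Mathlib.Algebra.MvPolynomial.PDeriv
import Mathlib.LinearAlgebra.Matrix.Determinant.Basic
import Mathlib.RingTheory.Polynomial.Basic

/-!
# Étale-open certificates of infinitude are first-order (line LonelyTranslates c1, stage D)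

For a ring formula `φ(x; y)` (set variables `Fin m`, parameters `Fin n`) and a complexity bound
`N`, there is ONE ring formula `Ψ_N(y)` expressing: "for some codimension `c < m`, some choice of
distinguished columns, some `r ≤ N`, and some coefficients, the GENERIC standard smooth datum
`S` (equations and localisation of multi-degree `≤ N`) and the GENERIC standard étale datum `E`
(`r` auxiliary variables, multi-degree `≤ N`) with these coefficients satisfy
`∅ ≠ E.image ∩ S.locus ⊆ φ(K^m; y)`" (`exists_certFormula`).  The atoms are box sums, their
partial derivatives and determinants of such (`stub_exists_term_realize_boxEval_pderiv`,
`stub_exists_term_realize_det`).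
-/

set_option linter.dupNamespace false

namespace Summit.MatrixMultiplication.MatrixMultiplication.Theorems.PairwiseCurvedTilingsLC.Negative

open FirstOrder FirstOrder.Language FirstOrder.Ring
open Literature.ModelTheory.PseudofiniteFields

section Atoms

variable {α : Type} {m N : ℕ}

/-- **The locus of the generic standard smooth datum is definable in its coefficients**: for
coefficient-variable names `fdg (i, β)`, `fdh β`, point-variable names `fx l` and columns
`cols`, one ring formula expresses `x ∈ S.locus` for the box datum `S` read off a valuation.
[folklore] -/
theorem definable_mem_boxLocus {c : ℕ} (fdg : Fin c × (Fin m → Fin (N + 1)) → α)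
    (fdh : (Fin m → Fin (N + 1)) → α) (fx : Fin m → α) (cols : Fin c ↪ Fin m) :
    ∃ θ : Language.ring.Formula α, ∀ (K : Type) [Field K] [CompatibleRing K] (v : α → K),
      θ.Realize v ↔ (fun l => v (fx l)) ∈
        (⟨fun i => ∑ β : Fin m → Fin (N + 1), MvPolynomial.monomial
            (Finsupp.equivFunOnFinite.symm fun l => (β l : ℕ)) (v (fdg (i, β))),
          ∑ β : Fin m → Fin (N + 1), MvPolynomial.monomial
            (Finsupp.equivFunOnFinite.symm fun l => (β l : ℕ)) (v (fdh β)),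
          cols⟩ : SmoothDatum K m c).locus := by
  classical
  -- atoms: equations, localisation, minor
  choose tg htg using fun i : Fin c =>
    (stub_exists_term_realize_boxEval_pderiv N (fun β => fdg (i, β)) fx).1
  obtain ⟨th, hth⟩ := (stub_exists_term_realize_boxEval_pderiv N fdh fx).1
  choose tM htM using fun (i : Fin c) (j : Fin c) =>
    (stub_exists_term_realize_boxEval_pderiv N (fun β => fdg (i, β)) fx).2 (cols j)
  obtain ⟨tΔ, htΔ⟩ := stub_exists_term_realize_det tM
  obtain ⟨θ₁, hθ₁⟩ := definable_iInf fun i : Fin c => definable_termEq (tg i) 0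
  obtain ⟨θ₂, hθ₂⟩ := definable_termNe th 0
  obtain ⟨θ₃, hθ₃⟩ := definable_termNe tΔ 0
  obtain ⟨θ, hθ⟩ := definable_and ⟨θ₁, hθ₁⟩ (definable_and ⟨θ₂, hθ₂⟩ ⟨θ₃, hθ₃⟩)
  refine ⟨θ, fun K _ _ v => ?_⟩
  rw [hθ, SmoothDatum.mem_locus_iff]
  simp only [htg, realize_zero, hth, htΔ]
  refine and_congr Iff.rfl (and_congr Iff.rfl ?_)
  rw [SmoothDatum.minor, RingHom.map_det]
  refine Iff.of_eq (congrArg (fun M : Matrix (Fin c) (Fin c) K => M.det ≠ 0) ?_)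
  ext i j
  simp only [Matrix.of_apply, RingHom.mapMatrix_apply, Matrix.map_apply, htM]

/-- **The image of the generic standard étale datum is definable in its coefficients** (with the
`r` auxiliary variables existentially quantified). [folklore] -/
theorem definable_mem_boxImage {r : ℕ} (fdG : Fin r × ((Fin m ⊕ Fin r) → Fin (N + 1)) → α)
    (fdH : ((Fin m ⊕ Fin r) → Fin (N + 1)) → α) (fx : Fin m → α) :
    ∃ θ : Language.ring.Formula α, ∀ (K : Type) [Field K] [CompatibleRing K] (v : α → K),
      θ.Realize v ↔ (fun l => v (fx l)) ∈
        (⟨fun i => ∑ β : (Fin m ⊕ Fin r) → Fin (N + 1), MvPolynomial.monomial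
            (Finsupp.equivFunOnFinite.symm fun l => (β l : ℕ)) (v (fdG (i, β))),
          ∑ β : (Fin m ⊕ Fin r) → Fin (N + 1), MvPolynomial.monomial
            (Finsupp.equivFunOnFinite.symm fun l => (β l : ℕ)) (v (fdH β))⟩ :
          EtaleDatum K m r).image := by
  classical
  -- work in the variables `α ⊕ Fin r` (the auxiliary block), then quantify it
  let fx' : Fin m ⊕ Fin r → α ⊕ Fin r := Sum.elim (fun l => Sum.inl (fx l)) Sum.inr
  choose tG htG using fun i : Fin r =>
    (stub_exists_term_realize_boxEval_pderiv N (fun β => (Sum.inl (fdG (i, β)) : α ⊕ Fin r)) fx').1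
  obtain ⟨tH, htH⟩ :=
    (stub_exists_term_realize_boxEval_pderiv N (fun β => (Sum.inl (fdH β) : α ⊕ Fin r)) fx').1
  choose tM htM using fun (i : Fin r) (j : Fin r) =>
    (stub_exists_term_realize_boxEval_pderiv N (fun β => (Sum.inl (fdG (i, β)) : α ⊕ Fin r)) fx').2
      (Sum.inr j)
  obtain ⟨tJ, htJ⟩ := stub_exists_term_realize_det tM
  obtain ⟨θ₁, hθ₁⟩ := definable_iInf fun i : Fin r => definable_termEq (tG i) 0
  obtain ⟨θ₂, hθ₂⟩ := definable_termNe tH 0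
  obtain ⟨θ₃, hθ₃⟩ := definable_termNe tJ 0
  obtain ⟨θ', hθ'⟩ := definable_and ⟨θ₁, hθ₁⟩ (definable_and ⟨θ₂, hθ₂⟩ ⟨θ₃, hθ₃⟩)
  obtain ⟨θ, hθ⟩ := definable_exists (α := α) (β := Fin r)
    (P := fun K _ _ v t => θ'.Realize (Sum.elim v t)) ⟨θ', fun K _ _ w => by
      refine Iff.of_eq (congrArg _ (funext fun s => ?_)); cases s <;> rfl⟩
  refine ⟨θ, fun K _ _ v => ?_⟩
  rw [hθ, EtaleDatum.mem_image_iff]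
  refine exists_congr fun t => ?_
  rw [hθ']
  have hval : (fun l => Sum.elim v t (fx' l)) = Sum.elim (fun l => v (fx l)) t := by
    funext l; rcases l with l | l <;> rfl
  simp only [htG, htH, realize_zero, hval, Sum.elim_inl]
  refine and_congr Iff.rfl (and_congr Iff.rfl ?_)
  rw [htJ, EtaleDatum.jacobianDet, RingHom.map_det]
  refine Iff.of_eq (congrArg (fun M : Matrix (Fin r) (Fin r) K => M.det ≠ 0) ?_)
  ext i j
  simp only [Matrix.of_apply, RingHom.mapMatrix_apply, Matrix.map_apply, htM, hval, Sum.elim_inl]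

end Atoms

section Certificate

/-- **The étale-open certificate of bounded complexity is one ring formula in the parameters.**
[folklore] -/
theorem exists_certFormula (m n N : ℕ) (φ : Language.ring.Formula (Fin m ⊕ Fin n)) :
    ∃ Ψ : Language.ring.Formula (Fin n), ∀ (K : Type) [Field K] [CompatibleRing K] (y : Fin n → K),
      Ψ.Realize y ↔ ∃ (c : Fin m) (cols : Fin c ↪ Fin m) (r : Fin (N + 1))
        (d : ((Fin c × (Fin m → Fin (N + 1))) ⊕ (Fin m → Fin (N + 1))) ⊕
          ((Fin r × ((Fin m ⊕ Fin r) → Fin (N + 1))) ⊕ ((Fin m ⊕ Fin r) → Fin (N + 1))) → K),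
        ((⟨fun i => ∑ β : (Fin m ⊕ Fin r) → Fin (N + 1), MvPolynomial.monomial
              (Finsupp.equivFunOnFinite.symm fun l => (β l : ℕ)) (d (Sum.inr (Sum.inl (i, β)))),
            ∑ β : (Fin m ⊕ Fin r) → Fin (N + 1), MvPolynomial.monomial
              (Finsupp.equivFunOnFinite.symm fun l => (β l : ℕ)) (d (Sum.inr (Sum.inr β)))⟩ :
            EtaleDatum K m r).image ∩
          (⟨fun i => ∑ β : Fin m → Fin (N + 1), MvPolynomial.monomial
              (Finsupp.equivFunOnFinite.symm fun l => (β l : ℕ)) (d (Sum.inl (Sum.inl (i, β)))),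
            ∑ β : Fin m → Fin (N + 1), MvPolynomial.monomial
              (Finsupp.equivFunOnFinite.symm fun l => (β l : ℕ)) (d (Sum.inl (Sum.inr β))),
            cols⟩ : SmoothDatum K m c).locus).Nonempty ∧
        (⟨fun i => ∑ β : (Fin m ⊕ Fin r) → Fin (N + 1), MvPolynomial.monomial
              (Finsupp.equivFunOnFinite.symm fun l => (β l : ℕ)) (d (Sum.inr (Sum.inl (i, β)))),
            ∑ β : (Fin m ⊕ Fin r) → Fin (N + 1), MvPolynomial.monomial
              (Finsupp.equivFunOnFinite.symm fun l => (β l : ℕ)) (d (Sum.inr (Sum.inr β)))⟩ :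
            EtaleDatum K m r).image ∩
          (⟨fun i => ∑ β : Fin m → Fin (N + 1), MvPolynomial.monomial
              (Finsupp.equivFunOnFinite.symm fun l => (β l : ℕ)) (d (Sum.inl (Sum.inl (i, β)))),
            ∑ β : Fin m → Fin (N + 1), MvPolynomial.monomial
              (Finsupp.equivFunOnFinite.symm fun l => (β l : ℕ)) (d (Sum.inl (Sum.inr β))),
            cols⟩ : SmoothDatum K m c).locus ⊆ {x | φ.Realize (Sum.elim x y)} := by
  classical
  -- for fixed shape `(c, cols, r)`: the formula in the variables `Fin n ⊕ VarD`
  have hshape : ∀ (c : Fin m) (cols : Fin c ↪ Fin m) (r : Fin (N + 1)),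
      ∃ θ : Language.ring.Formula (Fin n ⊕ (((Fin c × (Fin m → Fin (N + 1))) ⊕ (Fin m → Fin (N + 1))) ⊕
          ((Fin r × ((Fin m ⊕ Fin r) → Fin (N + 1))) ⊕ ((Fin m ⊕ Fin r) → Fin (N + 1))))),
        ∀ (K : Type) [Field K] [CompatibleRing K] (w : _ → K),
        θ.Realize w ↔
        ((⟨fun i => ∑ β : (Fin m ⊕ Fin r) → Fin (N + 1), MvPolynomial.monomial
              (Finsupp.equivFunOnFinite.symm fun l => (β l : ℕ)) (w (Sum.inr (Sum.inr (Sum.inl (i, β))))),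
            ∑ β : (Fin m ⊕ Fin r) → Fin (N + 1), MvPolynomial.monomial
              (Finsupp.equivFunOnFinite.symm fun l => (β l : ℕ)) (w (Sum.inr (Sum.inr (Sum.inr β))))⟩ :
            EtaleDatum K m r).image ∩
          (⟨fun i => ∑ β : Fin m → Fin (N + 1), MvPolynomial.monomial
              (Finsupp.equivFunOnFinite.symm fun l => (β l : ℕ)) (w (Sum.inr (Sum.inl (Sum.inl (i, β))))),
            ∑ β : Fin m → Fin (N + 1), MvPolynomial.monomial
              (Finsupp.equivFunOnFinite.symm fun l => (β l : ℕ)) (w (Sum.inr (Sum.inl (Sum.inr β)))),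
            cols⟩ : SmoothDatum K m c).locus).Nonempty ∧
        (⟨fun i => ∑ β : (Fin m ⊕ Fin r) → Fin (N + 1), MvPolynomial.monomial
              (Finsupp.equivFunOnFinite.symm fun l => (β l : ℕ)) (w (Sum.inr (Sum.inr (Sum.inl (i, β))))),
            ∑ β : (Fin m ⊕ Fin r) → Fin (N + 1), MvPolynomial.monomial
              (Finsupp.equivFunOnFinite.symm fun l => (β l : ℕ)) (w (Sum.inr (Sum.inr (Sum.inr β))))⟩ :
            EtaleDatum K m r).image ∩
          (⟨fun i => ∑ β : Fin m → Fin (N + 1), MvPolynomial.monomial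
              (Finsupp.equivFunOnFinite.symm fun l => (β l : ℕ)) (w (Sum.inr (Sum.inl (Sum.inl (i, β))))),
            ∑ β : Fin m → Fin (N + 1), MvPolynomial.monomial
              (Finsupp.equivFunOnFinite.symm fun l => (β l : ℕ)) (w (Sum.inr (Sum.inl (Sum.inr β)))),
            cols⟩ : SmoothDatum K m c).locus ⊆ {x | φ.Realize (Sum.elim x fun j => w (Sum.inl j))} := by
    intro c cols r
    -- nonemptiness: `∃ x, x ∈ image ∧ x ∈ locus`
    obtain ⟨θI, hθI⟩ := definable_mem_boxImage (m := m) (N := N) (r := r)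
      (α := (Fin n ⊕ (((Fin c × (Fin m → Fin (N + 1))) ⊕ (Fin m → Fin (N + 1))) ⊕
          ((Fin r × ((Fin m ⊕ Fin r) → Fin (N + 1))) ⊕ ((Fin m ⊕ Fin r) → Fin (N + 1))))) ⊕ Fin m)
      (fun p => Sum.inl (Sum.inr (Sum.inr (Sum.inl p)))) (fun β => Sum.inl (Sum.inr (Sum.inr (Sum.inr β))))
      Sum.inr
    obtain ⟨θL, hθL⟩ := definable_mem_boxLocus (m := m) (N := N) (c := c)
      (α := (Fin n ⊕ (((Fin c × (Fin m → Fin (N + 1))) ⊕ (Fin m → Fin (N + 1))) ⊕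
          ((Fin r × ((Fin m ⊕ Fin r) → Fin (N + 1))) ⊕ ((Fin m ⊕ Fin r) → Fin (N + 1))))) ⊕ Fin m)
      (fun p => Sum.inl (Sum.inr (Sum.inl (Sum.inl p)))) (fun β => Sum.inl (Sum.inr (Sum.inl (Sum.inr β))))
      Sum.inr cols
    obtain ⟨θφ, hθφ⟩ := definable_realize₂ φ
      (α := (Fin n ⊕ (((Fin c × (Fin m → Fin (N + 1))) ⊕ (Fin m → Fin (N + 1))) ⊕
          ((Fin r × ((Fin m ⊕ Fin r) → Fin (N + 1))) ⊕ ((Fin m ⊕ Fin r) → Fin (N + 1))))) ⊕ Fin m)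
      Sum.inr (fun j => Sum.inl (Sum.inl j))
    obtain ⟨θ₁, hθ₁⟩ := definable_exists (β := Fin m)
      (P := fun K _ _ v x => θI.Realize (Sum.elim v x) ∧ θL.Realize (Sum.elim v x))
      (by
        obtain ⟨θ, hθ⟩ := definable_and ⟨θI, fun K _ _ w => Iff.rfl⟩ ⟨θL, fun K _ _ w => Iff.rfl⟩
        exact ⟨θ, fun K _ _ w => by
          rw [hθ]
          refine Iff.of_eq (congrArg₂ (· ∧ ·) (congrArg _ ?_) (congrArg _ ?_)) <;>
            (funext s; cases s <;> rfl)⟩)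
    obtain ⟨θ₂, hθ₂⟩ := definable_forall (β := Fin m)
      (P := fun K _ _ v x => θI.Realize (Sum.elim v x) → θL.Realize (Sum.elim v x) →
        θφ.Realize (Sum.elim v x))
      (by
        obtain ⟨θ, hθ⟩ := definable_imp ⟨θI, fun K _ _ w => Iff.rfl⟩
          (definable_imp ⟨θL, fun K _ _ w => Iff.rfl⟩ ⟨θφ, fun K _ _ w => Iff.rfl⟩)
        exact ⟨θ, fun K _ _ w => by
          rw [hθ]
          have : (Sum.elim (fun a => w (Sum.inl a)) fun b => w (Sum.inr b)) = w := by
            funext s; cases s <;> rfl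
          rw [this]⟩)
    obtain ⟨θ, hθ⟩ := definable_and ⟨θ₁, hθ₁⟩ ⟨θ₂, hθ₂⟩
    refine ⟨θ, fun K _ _ w => ?_⟩
    rw [hθ]
    simp only [hθI, hθL, hθφ, Sum.elim_inr, Sum.elim_inl]
    refine and_congr ?_ ?_
    · exact ⟨fun ⟨x, hx⟩ => ⟨x, hx⟩, fun ⟨x, hx⟩ => ⟨x, hx⟩⟩
    · refine forall_congr' fun x => ?_
      simp only [Set.mem_inter_iff, Set.mem_setOf_eq, and_imp]
  -- the big disjunction over shapes, then the coefficient block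
  choose θs hθs using hshape
  have hblock : ∀ (c : Fin m) (cols : Fin c ↪ Fin m) (r : Fin (N + 1)),
      ∃ θ : Language.ring.Formula (Fin n), ∀ (K : Type) [Field K] [CompatibleRing K] (y : Fin n → K),
        θ.Realize y ↔ ∃ d : (((Fin c × (Fin m → Fin (N + 1))) ⊕ (Fin m → Fin (N + 1))) ⊕
          ((Fin r × ((Fin m ⊕ Fin r) → Fin (N + 1))) ⊕ ((Fin m ⊕ Fin r) → Fin (N + 1)))) → K,
          (θs c cols r).Realize (Sum.elim y d) := by
    intro c cols r
    exact definable_exists (P := fun K _ _ y d => (θs c cols r).Realize (Sum.elim y d))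
      ⟨θs c cols r, fun K _ _ w => by
        refine Iff.of_eq (congrArg _ ?_); funext s; cases s <;> rfl⟩
  choose θb hθb using hblock
  obtain ⟨Ψ, hΨ⟩ := definable_iSup (α := Fin n) fun c : Fin m =>
    definable_iSup (α := Fin n) fun cols : Fin c ↪ Fin m =>
      definable_iSup (α := Fin n) fun r : Fin (N + 1) => ⟨θb c cols r, hθb c cols r⟩
  refine ⟨Ψ, fun K _ _ y => ?_⟩
  rw [hΨ]
  refine exists_congr fun c => exists_congr fun cols => exists_congr fun r => ?_
  refine exists_congr fun d => ?_
  rw [hθs]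
  simp only [Sum.elim_inl, Sum.elim_inr]

end Certificate


end Summit.MatrixMultiplication.MatrixMultiplication.Theorems.PairwiseCurvedTilingsLC.Negative
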